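import Summits.Ventures.HodgeRepro2.T5HeckePolynomialAlgebra
import Summits.Ventures.HodgeRepro2.T5HeckeConvolution

/-!
# T5HeckeCellFiltration — the cell basis of `H(U(2,1), K_U)` is a FILTRATION:
# `T₁ · Tₙ ∈ span(T₀, …, T_{n+1})` (the support half of the leading-term property)

Tier-5 kernel support (seat p8, blind lane; sub-step N3).  T5-180 reduced the algebra half of
Satake to the leading-term property `T₁ · Tₙ ∈ T_{n+1} + span(T₀, …, Tₙ)`.  This file proves its
SUPPORT half: the product `T₁ · Tₙ` of two cell operators of `H(U(J₃(u)), K_U)` lies in the span of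
the cells `T₀, …, T_{n+1}`.  The proof reads T5-5x's structure-constant formula
`((T_g T_h) δ_K)(zK) = #{xK ⊆ KhK : x⁻¹ z ∈ KgK}` (`coeff_doubleCosetOp_mul_apply_single_one`): a
coset `zK` in the support has `z = x · (x⁻¹z)` with `x ∈ K a_n K` and `x⁻¹ z ∈ K a₁ K`, so `ϖ^{n+1}`
clears the denominators of `z` (T5-134's `Clears`, multiplicative — `clears_mul`), and by the
Cartan decomposition (T5-136's `cellClass_surjective`) `z ∈ K a_m K` with `m ≤ n + 1`
(`clears_pow_cell_iff`); a `K`-invariant vector supported on the cells `m ≤ n + 1` is the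
combination of their orbit vectors with coefficients its values at `a_m K`.

* `clears_mul` — `d₁` clears `A`, `d₂` clears `B` ⇒ `d₁ d₂` clears `A · B`;
* `exists_mem_orbit_cellU` — every coset `gK` lies in some cell `K a_m K` (Cartan);
* `clears_pow_of_mem_orbit_cellU` / `le_of_clears_pow_of_mem_orbit_cellU` — the cell index is the
  denominator exponent;
* `coeff_mul_eq_zero_of_forall_not_mem` — `(T₁ Tₙ) δ_K` vanishes off the cells `≤ n + 1`;
* `mul_eq_sum_smul`, **`mul_mem_span_cells`** — `T₁ · Tₙ = Σ_{m ≤ n+1} c_m T_m`, hence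
  `T₁ · Tₙ ∈ span(T₀, …, T_{n+1})`; `mul_mem_span_cells'` — the general `T_j · Tₙ ∈ span(T₀ … T_{n+j})`.

What stays prose: the TOP coefficient `c_{n+1} = 1` (T5-180's `hlead` needs
`T₁ Tₙ − T_{n+1} ∈ span(T₀ … Tₙ)`); with this file, `hlead` is exactly the statement
`c_{n+1} = 1`.  No `sorry`, no axiom beyond `propext`, `Classical.choice`, `Quot.sound`.
-/

namespace Summit.Ventures.HodgeRepro2.T5HeckeCellFiltration

open Submodule

section Clears

variable {R E : Type*} [CommRing R] [Field E] [Algebra R E] {ι : Type*} [Fintype ι]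

/-- `d₁` clears `A` and `d₂` clears `B` ⇒ `d₁ d₂` clears `A * B` (entries of the product are
sums of products). -/
theorem clears_mul {d₁ d₂ : E} {A B : Matrix ι ι E} (hA : T5CartanCellsDistinct.Clears R d₁ A)
    (hB : T5CartanCellsDistinct.Clears R d₂ B) :
    T5CartanCellsDistinct.Clears R (d₁ * d₂) (A * B) := by
  intro i j
  rw [Matrix.mul_apply, Finset.mul_sum]
  refine Subsemiring.sum_mem _ fun l _ => ?_
  have : d₁ * d₂ * (A i l * B l j) = (d₁ * A i l) * (d₂ * B l j) := by ring
  rw [this]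
  exact Subsemiring.mul_mem _ (hA i l) (hB l j)

end Clears

section Cells

variable {R : Type*} {E : Type*} [CommRing R] [Field E] [StarRing E] [Algebra R E]
  [IsFractionRing R E] [IsDomain R] [IsDiscreteValuationRing R] [Finite (IsLocalRing.ResidueField R)]
  (hstar : ∀ x : E, IsLocalization.IsInteger R x → IsLocalization.IsInteger R (star x))
  (u : E) (hsu : star u = u) (hu0 : u ≠ 0) (hu : IsLocalization.IsInteger R u)
  (hu' : IsLocalization.IsInteger R u⁻¹) {ϖ : R} (hϖ : Irreducible ϖ)
  (hs : star (algebraMap R E ϖ) = algebraMap R E ϖ)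

omit [IsDomain R] [IsDiscreteValuationRing R] [Finite (IsLocalRing.ResidueField R)] in
/-- A coset in the orbit of the `m`-th cell is `κ · a_m · κ'` with `κ, κ' ∈ K_U`. -/
theorem exists_eq_mul_cellU_mul_of_mem_orbit
    {g : T5UnitaryGroupForm.formUnitaryGroup (T5HermitianThreeElements.J3 u)} {m : ℕ}
    (hg : (g : T5UnitaryGroupForm.formUnitaryGroup (T5HermitianThreeElements.J3 u) ⧸
        T5UnitaryHeckeAdjoint.hyperspecialSubgroup R (T5HermitianThreeElements.J3 u)) ∈
      MulAction.orbit (T5UnitaryHeckeAdjoint.hyperspecialSubgroup R (T5HermitianThreeElements.J3 u))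
        (T5HeckeBasisCells.cellU hϖ hs u m :
          T5UnitaryGroupForm.formUnitaryGroup (T5HermitianThreeElements.J3 u) ⧸
            T5UnitaryHeckeAdjoint.hyperspecialSubgroup R (T5HermitianThreeElements.J3 u))) :
    ∃ κ ∈ T5UnitaryHeckeAdjoint.hyperspecialSubgroup R (T5HermitianThreeElements.J3 u),
      ∃ κ' ∈ T5UnitaryHeckeAdjoint.hyperspecialSubgroup R (T5HermitianThreeElements.J3 u),
        g = κ * T5HeckeBasisCells.cellU hϖ hs u m * κ' := by
  obtain ⟨κ, hκ⟩ := MulAction.mem_orbit_iff.mp hg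
  have hκ' : ((↑κ * T5HeckeBasisCells.cellU hϖ hs u m :
      T5UnitaryGroupForm.formUnitaryGroup (T5HermitianThreeElements.J3 u)) :
        T5UnitaryGroupForm.formUnitaryGroup (T5HermitianThreeElements.J3 u) ⧸
          T5UnitaryHeckeAdjoint.hyperspecialSubgroup R (T5HermitianThreeElements.J3 u)) = (g : _) := hκ
  rw [QuotientGroup.eq] at hκ'
  refine ⟨κ, κ.2, (↑κ * T5HeckeBasisCells.cellU hϖ hs u m)⁻¹ * g, hκ', ?_⟩
  group

omit [IsDomain R] [IsDiscreteValuationRing R] [Finite (IsLocalRing.ResidueField R)] in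
/-- In the orbit of the `m`-th cell, `ϖ^m` clears the denominators. -/
theorem clears_pow_of_mem_orbit_cellU
    {g : T5UnitaryGroupForm.formUnitaryGroup (T5HermitianThreeElements.J3 u)} {m : ℕ}
    (hg : (g : T5UnitaryGroupForm.formUnitaryGroup (T5HermitianThreeElements.J3 u) ⧸
        T5UnitaryHeckeAdjoint.hyperspecialSubgroup R (T5HermitianThreeElements.J3 u)) ∈
      MulAction.orbit (T5UnitaryHeckeAdjoint.hyperspecialSubgroup R (T5HermitianThreeElements.J3 u))
        (T5HeckeBasisCells.cellU hϖ hs u m :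
          T5UnitaryGroupForm.formUnitaryGroup (T5HermitianThreeElements.J3 u) ⧸
            T5UnitaryHeckeAdjoint.hyperspecialSubgroup R (T5HermitianThreeElements.J3 u))) :
    T5CartanCellsDistinct.Clears R (algebraMap R E ϖ ^ (m : ℤ)) ((g : GL (Fin 3) E) : Matrix (Fin 3) (Fin 3) E) := by
  obtain ⟨κ, hκ, κ', hκ', rfl⟩ := exists_eq_mul_cellU_mul_of_mem_orbit u hϖ hs hg
  rw [Subgroup.coe_mul, Subgroup.coe_mul, Units.val_mul, Units.val_mul]
  rw [T5CartanCellsDistinct.clears_mul_mul_iff _ _ ((T5UnitaryHeckeAdjoint.mem_hyperspecialSubgroup_iff R κ).mp hκ)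
    ((T5UnitaryHeckeAdjoint.mem_hyperspecialSubgroup_iff R κ').mp hκ')]
  exact (T5CartanCellsDistinct.clears_pow_cell_iff hϖ m m).mpr le_rfl

omit [IsDomain R] [IsDiscreteValuationRing R] [Finite (IsLocalRing.ResidueField R)] in
/-- If `ϖ^l` clears the denominators of `g` and `gK` lies in the orbit of the `m`-th cell, then
`m ≤ l` (the cell index is the denominator exponent — T5-134). -/
theorem le_of_clears_pow_of_mem_orbit_cellU
    {g : T5UnitaryGroupForm.formUnitaryGroup (T5HermitianThreeElements.J3 u)} {m l : ℕ}
    (h : T5CartanCellsDistinct.Clears R (algebraMap R E ϖ ^ (l : ℤ)) ((g : GL (Fin 3) E) : Matrix (Fin 3) (Fin 3) E))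
    (hg : (g : T5UnitaryGroupForm.formUnitaryGroup (T5HermitianThreeElements.J3 u) ⧸
        T5UnitaryHeckeAdjoint.hyperspecialSubgroup R (T5HermitianThreeElements.J3 u)) ∈
      MulAction.orbit (T5UnitaryHeckeAdjoint.hyperspecialSubgroup R (T5HermitianThreeElements.J3 u))
        (T5HeckeBasisCells.cellU hϖ hs u m :
          T5UnitaryGroupForm.formUnitaryGroup (T5HermitianThreeElements.J3 u) ⧸
            T5UnitaryHeckeAdjoint.hyperspecialSubgroup R (T5HermitianThreeElements.J3 u))) :
    m ≤ l := by
  obtain ⟨κ, hκ, κ', hκ', rfl⟩ := exists_eq_mul_cellU_mul_of_mem_orbit u hϖ hs hg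
  rw [Subgroup.coe_mul, Subgroup.coe_mul, Units.val_mul, Units.val_mul,
    T5CartanCellsDistinct.clears_mul_mul_iff _ _ ((T5UnitaryHeckeAdjoint.mem_hyperspecialSubgroup_iff R κ).mp hκ)
      ((T5UnitaryHeckeAdjoint.mem_hyperspecialSubgroup_iff R κ').mp hκ')] at h
  exact (T5CartanCellsDistinct.clears_pow_cell_iff hϖ m l).mp h

include hstar hsu hu0 hu hu' in
/-- **Cartan**: every coset `gK` lies in the orbit of some cell `K a_m K` (T5-136's
`cellClass_surjective`; every double coset of `K_U` is finite by T5-5x's pullback instance). -/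
theorem exists_mem_orbit_cellU (g : T5UnitaryGroupForm.formUnitaryGroup (T5HermitianThreeElements.J3 u)) :
    ∃ m : ℕ, (g : T5UnitaryGroupForm.formUnitaryGroup (T5HermitianThreeElements.J3 u) ⧸
        T5UnitaryHeckeAdjoint.hyperspecialSubgroup R (T5HermitianThreeElements.J3 u)) ∈
      MulAction.orbit (T5UnitaryHeckeAdjoint.hyperspecialSubgroup R (T5HermitianThreeElements.J3 u))
        (T5HeckeBasisCells.cellU hϖ hs u m :
          T5UnitaryGroupForm.formUnitaryGroup (T5HermitianThreeElements.J3 u) ⧸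
            T5UnitaryHeckeAdjoint.hyperspecialSubgroup R (T5HermitianThreeElements.J3 u)) := by
  obtain ⟨m, hm⟩ := T5HeckeBasisCells.cellClass_surjective hstar u hsu hu0 hu hu' hϖ hs
    (T5HeckeBasisCells.classOf (T5UnitaryHeckeAdjoint.hyperspecialSubgroup R (T5HermitianThreeElements.J3 u)) g)
  have hm' := (T5HeckeBasisCells.classOf_eq_iff _ _ _).mp hm
  exact ⟨m, MulAction.orbit_eq_iff.mp hm'.symm⟩

include hstar hsu hu0 hu hu' in
/-- **The support of `T_j · Tₙ`**: the coefficient of `(T_j Tₙ) δ_K` at a coset `zK` outside the cells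
`K a_m K`, `m ≤ n + j`, is `0` (T5-5x's structure-constant formula: a contributing `xK ⊆ K a_n K`
has `x⁻¹ z ∈ K a_j K`, so `ϖ^{n+j}` clears `z = x · x⁻¹z`, and `z`'s cell index is `≤ n + j`). -/
theorem coeff_mul_cellU_eq_zero (k : Type*) [Field k] {j n : ℕ}
    (z : T5UnitaryGroupForm.formUnitaryGroup (T5HermitianThreeElements.J3 u) ⧸
      T5UnitaryHeckeAdjoint.hyperspecialSubgroup R (T5HermitianThreeElements.J3 u))
    (hz : ∀ m, m < n + j + 1 → z ∉ MulAction.orbit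
      (T5UnitaryHeckeAdjoint.hyperspecialSubgroup R (T5HermitianThreeElements.J3 u))
      (T5HeckeBasisCells.cellU hϖ hs u m :
        T5UnitaryGroupForm.formUnitaryGroup (T5HermitianThreeElements.J3 u) ⧸
          T5UnitaryHeckeAdjoint.hyperspecialSubgroup R (T5HermitianThreeElements.J3 u))) :
    (((T5HeckeDoubleCoset.doubleCosetOp k
        (T5UnitaryHeckeAdjoint.hyperspecialSubgroup R (T5HermitianThreeElements.J3 u))
        (T5HeckeBasisCells.cellU hϖ hs u j) *
      T5HeckeDoubleCoset.doubleCosetOp k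
        (T5UnitaryHeckeAdjoint.hyperspecialSubgroup R (T5HermitianThreeElements.J3 u))
        (T5HeckeBasisCells.cellU hϖ hs u n) :
        T5HeckePermutationModule.heckeAlgebra k
          (T5UnitaryHeckeAdjoint.hyperspecialSubgroup R (T5HermitianThreeElements.J3 u))) :
        Module.End k (MonoidAlgebra k
          (T5UnitaryGroupForm.formUnitaryGroup (T5HermitianThreeElements.J3 u) ⧸
            T5UnitaryHeckeAdjoint.hyperspecialSubgroup R (T5HermitianThreeElements.J3 u))))
        (MonoidAlgebra.single
          (↑(1 : T5UnitaryGroupForm.formUnitaryGroup (T5HermitianThreeElements.J3 u))) (1 : k))).coeff z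
      = 0 := by
  rw [T5HeckeConvolution.coeff_doubleCosetOp_mul_apply_single_one]
  have hϖ0 : algebraMap R E ϖ ≠ 0 := (map_ne_zero_iff _ (IsFractionRing.injective R E)).mpr hϖ.ne_zero
  have hS : (MulAction.orbit (T5UnitaryHeckeAdjoint.hyperspecialSubgroup R (T5HermitianThreeElements.J3 u))
      (T5HeckeBasisCells.cellU hϖ hs u n :
        T5UnitaryGroupForm.formUnitaryGroup (T5HermitianThreeElements.J3 u) ⧸
          T5UnitaryHeckeAdjoint.hyperspecialSubgroup R (T5HermitianThreeElements.J3 u)) ∩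
      {x | (Quotient.out x)⁻¹ • z ∈ MulAction.orbit
        (T5UnitaryHeckeAdjoint.hyperspecialSubgroup R (T5HermitianThreeElements.J3 u))
        (T5HeckeBasisCells.cellU hϖ hs u j :
          T5UnitaryGroupForm.formUnitaryGroup (T5HermitianThreeElements.J3 u) ⧸
            T5UnitaryHeckeAdjoint.hyperspecialSubgroup R (T5HermitianThreeElements.J3 u))}) = ∅ := by
    rw [Set.eq_empty_iff_forall_notMem]
    rintro x ⟨hx1, hx2⟩
    have hx' := QuotientGroup.out_eq' x
    have hz' := QuotientGroup.out_eq' z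
    have h1 : (((Quotient.out x)⁻¹ * Quotient.out z :
        T5UnitaryGroupForm.formUnitaryGroup (T5HermitianThreeElements.J3 u)) :
          T5UnitaryGroupForm.formUnitaryGroup (T5HermitianThreeElements.J3 u) ⧸
            T5UnitaryHeckeAdjoint.hyperspecialSubgroup R (T5HermitianThreeElements.J3 u)) ∈
        MulAction.orbit (T5UnitaryHeckeAdjoint.hyperspecialSubgroup R (T5HermitianThreeElements.J3 u))
          (T5HeckeBasisCells.cellU hϖ hs u j :
            T5UnitaryGroupForm.formUnitaryGroup (T5HermitianThreeElements.J3 u) ⧸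
              T5UnitaryHeckeAdjoint.hyperspecialSubgroup R (T5HermitianThreeElements.J3 u)) := by
      have : (Quotient.out x)⁻¹ • z = (((Quotient.out x)⁻¹ * Quotient.out z :
          T5UnitaryGroupForm.formUnitaryGroup (T5HermitianThreeElements.J3 u)) :
            T5UnitaryGroupForm.formUnitaryGroup (T5HermitianThreeElements.J3 u) ⧸
              T5UnitaryHeckeAdjoint.hyperspecialSubgroup R (T5HermitianThreeElements.J3 u)) := by
        conv_lhs => rw [← hz']
        rfl
      rw [← this]
      exact hx2
    have hc1 := clears_pow_of_mem_orbit_cellU u hϖ hs h1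
    have hcn := clears_pow_of_mem_orbit_cellU u hϖ hs (hx' ▸ hx1)
    have hz'' : T5CartanCellsDistinct.Clears R (algebraMap R E ϖ ^ ((n + j : ℕ) : ℤ))
        (((Quotient.out z : T5UnitaryGroupForm.formUnitaryGroup (T5HermitianThreeElements.J3 u)) :
          GL (Fin 3) E) : Matrix (Fin 3) (Fin 3) E) := by
      have := clears_mul hcn hc1
      rw [← Units.val_mul, ← Subgroup.coe_mul, mul_inv_cancel_left, ← zpow_add₀ hϖ0] at this
      simpa using this
    obtain ⟨m, hm⟩ := exists_mem_orbit_cellU hstar u hsu hu0 hu hu' hϖ hs (Quotient.out z)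
    have hle := le_of_clears_pow_of_mem_orbit_cellU u hϖ hs hz'' hm
    exact hz m (by omega) (hz' ▸ hm)
  rw [hS, Set.ncard_empty, Nat.cast_zero]

include hstar hsu hu0 hu hu' in
/-- **The expansion of `(T_j Tₙ) δ_K`** in the orbit vectors of the cells `m ≤ n + j`, with
coefficients its values at `a_m K`. -/
theorem mul_cellU_apply_single_one_eq_sum (k : Type*) [Field k] (j n : ℕ) :
    ((T5HeckeDoubleCoset.doubleCosetOp k
        (T5UnitaryHeckeAdjoint.hyperspecialSubgroup R (T5HermitianThreeElements.J3 u))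
        (T5HeckeBasisCells.cellU hϖ hs u j) *
      T5HeckeDoubleCoset.doubleCosetOp k
        (T5UnitaryHeckeAdjoint.hyperspecialSubgroup R (T5HermitianThreeElements.J3 u))
        (T5HeckeBasisCells.cellU hϖ hs u n) :
        T5HeckePermutationModule.heckeAlgebra k
          (T5UnitaryHeckeAdjoint.hyperspecialSubgroup R (T5HermitianThreeElements.J3 u))) :
        Module.End k (MonoidAlgebra k
          (T5UnitaryGroupForm.formUnitaryGroup (T5HermitianThreeElements.J3 u) ⧸
            T5UnitaryHeckeAdjoint.hyperspecialSubgroup R (T5HermitianThreeElements.J3 u))))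
        (MonoidAlgebra.single
          (↑(1 : T5UnitaryGroupForm.formUnitaryGroup (T5HermitianThreeElements.J3 u))) (1 : k)) =
      ∑ m ∈ Finset.range (n + j + 1),
        (((T5HeckeDoubleCoset.doubleCosetOp k
            (T5UnitaryHeckeAdjoint.hyperspecialSubgroup R (T5HermitianThreeElements.J3 u))
            (T5HeckeBasisCells.cellU hϖ hs u j) *
          T5HeckeDoubleCoset.doubleCosetOp k
            (T5UnitaryHeckeAdjoint.hyperspecialSubgroup R (T5HermitianThreeElements.J3 u))
            (T5HeckeBasisCells.cellU hϖ hs u n) :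
            T5HeckePermutationModule.heckeAlgebra k
              (T5UnitaryHeckeAdjoint.hyperspecialSubgroup R (T5HermitianThreeElements.J3 u))) :
            Module.End k (MonoidAlgebra k
              (T5UnitaryGroupForm.formUnitaryGroup (T5HermitianThreeElements.J3 u) ⧸
                T5UnitaryHeckeAdjoint.hyperspecialSubgroup R (T5HermitianThreeElements.J3 u))))
            (MonoidAlgebra.single
              (↑(1 : T5UnitaryGroupForm.formUnitaryGroup (T5HermitianThreeElements.J3 u))) (1 : k))).coeff
          (T5HeckeBasisCells.cellU hϖ hs u m) •
        T5HeckeDoubleCoset.orbitVector k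
          (T5UnitaryHeckeAdjoint.hyperspecialSubgroup R (T5HermitianThreeElements.J3 u))
          (MulAction.orbit (T5UnitaryHeckeAdjoint.hyperspecialSubgroup R (T5HermitianThreeElements.J3 u))
            (T5HeckeBasisCells.cellU hϖ hs u m :
              T5UnitaryGroupForm.formUnitaryGroup (T5HermitianThreeElements.J3 u) ⧸
                T5UnitaryHeckeAdjoint.hyperspecialSubgroup R (T5HermitianThreeElements.J3 u))) := by
  classical
  set P := T5HeckeDoubleCoset.doubleCosetOp k
        (T5UnitaryHeckeAdjoint.hyperspecialSubgroup R (T5HermitianThreeElements.J3 u))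
        (T5HeckeBasisCells.cellU hϖ hs u j) *
      T5HeckeDoubleCoset.doubleCosetOp k
        (T5UnitaryHeckeAdjoint.hyperspecialSubgroup R (T5HermitianThreeElements.J3 u))
        (T5HeckeBasisCells.cellU hϖ hs u n) with hP
  set t := (P : Module.End k (MonoidAlgebra k
          (T5UnitaryGroupForm.formUnitaryGroup (T5HermitianThreeElements.J3 u) ⧸
            T5UnitaryHeckeAdjoint.hyperspecialSubgroup R (T5HermitianThreeElements.J3 u))))
        (MonoidAlgebra.single
          (↑(1 : T5UnitaryGroupForm.formUnitaryGroup (T5HermitianThreeElements.J3 u))) (1 : k)) with ht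
  have hinv : t ∈ LevelPositivity.invariants (Representation.ofMulAction k
      (T5UnitaryGroupForm.formUnitaryGroup (T5HermitianThreeElements.J3 u))
      (T5UnitaryGroupForm.formUnitaryGroup (T5HermitianThreeElements.J3 u) ⧸
        T5UnitaryHeckeAdjoint.hyperspecialSubgroup R (T5HermitianThreeElements.J3 u)))
      (T5UnitaryHeckeAdjoint.hyperspecialSubgroup R (T5HermitianThreeElements.J3 u)) := by
    have h := (T5HeckePermutationModule.heckeAlgebraEquivInvariants P).2
    rwa [T5HeckePermutationModule.heckeAlgebraEquivInvariants_apply] at h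
  have hinv' := (T5HeckeDoubleCosetBasis.mem_invariants_ofMulAction_iff).mp hinv
  apply MonoidAlgebra.ext
  ext z
  rw [MonoidAlgebra.coeff_sum, Finsupp.finsetSum_apply]
  simp only [MonoidAlgebra.coeff_smul, Finsupp.smul_apply, smul_eq_mul]
  simp only [T5HeckeConvolution.coeff_orbitVector_eq_ite (Set.toFinite _) z]
  by_cases hz : ∃ m, m < n + j + 1 ∧ z ∈ MulAction.orbit
      (T5UnitaryHeckeAdjoint.hyperspecialSubgroup R (T5HermitianThreeElements.J3 u))
      (T5HeckeBasisCells.cellU hϖ hs u m :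
        T5UnitaryGroupForm.formUnitaryGroup (T5HermitianThreeElements.J3 u) ⧸
          T5UnitaryHeckeAdjoint.hyperspecialSubgroup R (T5HermitianThreeElements.J3 u))
  · obtain ⟨m₀, hm₀, hz₀⟩ := hz
    rw [Finset.sum_eq_single m₀]
    · rw [if_pos hz₀, mul_one]
      obtain ⟨κ, hκ⟩ := MulAction.mem_orbit_iff.mp hz₀
      rw [← hκ]
      change t.coeff ((κ : T5UnitaryGroupForm.formUnitaryGroup (T5HermitianThreeElements.J3 u)) •
        (T5HeckeBasisCells.cellU hϖ hs u m₀ :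
          T5UnitaryGroupForm.formUnitaryGroup (T5HermitianThreeElements.J3 u) ⧸
            T5UnitaryHeckeAdjoint.hyperspecialSubgroup R (T5HermitianThreeElements.J3 u))) = _
      exact hinv' _ κ.2 _
    · intro m _ hne
      rw [if_neg, mul_zero]
      intro hzm
      apply hne
      exact (T5HeckeBasisCells.orbit_cell_eq_iff hϖ hs u m m₀).mp
        ((MulAction.orbit_eq_iff.mpr hzm).symm.trans (MulAction.orbit_eq_iff.mpr hz₀))
    · intro h
      exact absurd (Finset.mem_range.mpr hm₀) h
  · push Not at hz
    rw [coeff_mul_cellU_eq_zero hstar u hsu hu0 hu hu' hϖ hs k z hz]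
    symm
    apply Finset.sum_eq_zero
    intro m hm
    rw [if_neg (hz m (Finset.mem_range.mp hm)), mul_zero]

include hstar hsu hu0 hu hu' in
/-- **`T_j · Tₙ = Σ_{m ≤ n + j} c_m T_m`** in `H(U(J₃(u)), K_U)`, with
`c_m = ((T_j Tₙ) δ_K)(a_m K)` (transported through `H(G,K) ≃ k[G/K]^K`). -/
theorem mul_cellU_eq_sum (k : Type*) [Field k] (j n : ℕ) :
    T5HeckeBasisCells.heckeBasisCells hstar u hsu hu0 hu hu' hϖ hs k j *
        T5HeckeBasisCells.heckeBasisCells hstar u hsu hu0 hu hu' hϖ hs k n =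
      ∑ m ∈ Finset.range (n + j + 1),
        (((T5HeckeDoubleCoset.doubleCosetOp k
            (T5UnitaryHeckeAdjoint.hyperspecialSubgroup R (T5HermitianThreeElements.J3 u))
            (T5HeckeBasisCells.cellU hϖ hs u j) *
          T5HeckeDoubleCoset.doubleCosetOp k
            (T5UnitaryHeckeAdjoint.hyperspecialSubgroup R (T5HermitianThreeElements.J3 u))
            (T5HeckeBasisCells.cellU hϖ hs u n) :
            T5HeckePermutationModule.heckeAlgebra k
              (T5UnitaryHeckeAdjoint.hyperspecialSubgroup R (T5HermitianThreeElements.J3 u))) :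
            Module.End k (MonoidAlgebra k
              (T5UnitaryGroupForm.formUnitaryGroup (T5HermitianThreeElements.J3 u) ⧸
                T5UnitaryHeckeAdjoint.hyperspecialSubgroup R (T5HermitianThreeElements.J3 u))))
            (MonoidAlgebra.single
              (↑(1 : T5UnitaryGroupForm.formUnitaryGroup (T5HermitianThreeElements.J3 u))) (1 : k))).coeff
          (T5HeckeBasisCells.cellU hϖ hs u m) •
        T5HeckeBasisCells.heckeBasisCells hstar u hsu hu0 hu hu' hϖ hs k m := by
  apply T5HeckePermutationModule.heckeAlgebraEquivInvariants.injective
  have hmap : ∀ (s : Finset ℕ) (c : ℕ → k)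
      (f : ℕ → T5HeckePermutationModule.heckeAlgebra k
        (T5UnitaryHeckeAdjoint.hyperspecialSubgroup R (T5HermitianThreeElements.J3 u))),
      T5HeckePermutationModule.heckeAlgebraEquivInvariants (∑ m ∈ s, c m • f m) =
        ∑ m ∈ s, c m • T5HeckePermutationModule.heckeAlgebraEquivInvariants (f m) := by
    intro s c f
    induction s using Finset.induction_on with
    | empty => simp only [Finset.sum_empty, LinearEquiv.map_zero]
    | insert a s ha ih =>
      rw [Finset.sum_insert ha, Finset.sum_insert ha, LinearEquiv.map_add, LinearEquiv.map_smul, ih]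
  rw [hmap]
  apply Subtype.ext
  rw [Submodule.coe_sum]
  simp only [Submodule.coe_smul, T5HeckePermutationModule.heckeAlgebraEquivInvariants_apply,
    T5HeckeBasisCells.heckeBasisCells_apply, T5HeckeDoubleCoset.doubleCosetOp_apply_single_one]
  exact mul_cellU_apply_single_one_eq_sum hstar u hsu hu0 hu hu' hϖ hs k j n

include hstar hsu hu0 hu hu' in
/-- **THE CELL FILTRATION**: `T_j · Tₙ ∈ span(T₀, …, T_{n+j})` in `H(U(J₃(u)), K_U)`. -/
theorem mul_mem_span_cells' (k : Type*) [Field k] (j n : ℕ) :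
    T5HeckeBasisCells.heckeBasisCells hstar u hsu hu0 hu hu' hϖ hs k j *
        T5HeckeBasisCells.heckeBasisCells hstar u hsu hu0 hu hu' hϖ hs k n ∈
      span k (⇑(T5HeckeBasisCells.heckeBasisCells hstar u hsu hu0 hu hu' hϖ hs k) '' {i | i < n + j + 1}) := by
  rw [mul_cellU_eq_sum hstar u hsu hu0 hu hu' hϖ hs k j n]
  exact Submodule.sum_mem _ fun m hm =>
    Submodule.smul_mem _ _ (subset_span ⟨m, Finset.mem_range.mp hm, rfl⟩)

include hstar hsu hu0 hu hu' in
/-- **The support half of the leading-term property** (T5-180's `hlead`):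
`T₁ · Tₙ ∈ span(T₀, …, T_{n+1})`. -/
theorem mul_mem_span_cells (k : Type*) [Field k] (n : ℕ) :
    T5HeckeBasisCells.heckeBasisCells hstar u hsu hu0 hu hu' hϖ hs k 1 *
        T5HeckeBasisCells.heckeBasisCells hstar u hsu hu0 hu hu' hϖ hs k n ∈
      span k (⇑(T5HeckeBasisCells.heckeBasisCells hstar u hsu hu0 hu hu' hϖ hs k) '' {i | i < n + 2}) :=
  mul_mem_span_cells' hstar u hsu hu0 hu hu' hϖ hs k 1 n

include hstar hsu hu0 hu hu' in
/-- **`hlead` is exactly «the top coefficient is `1`»**: if `((T₁ Tₙ) δ_K)(a_{n+1} K) = 1` for every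
`n`, then T5-180's leading-term property holds, hence `H(U(J₃(u)), K_U) = k[T₁]`. -/
theorem aeval_bijective_of_top_coeff (k : Type*) [Field k]
    (htop : ∀ n : ℕ, (((T5HeckeDoubleCoset.doubleCosetOp k
            (T5UnitaryHeckeAdjoint.hyperspecialSubgroup R (T5HermitianThreeElements.J3 u))
            (T5HeckeBasisCells.cellU hϖ hs u 1) *
          T5HeckeDoubleCoset.doubleCosetOp k
            (T5UnitaryHeckeAdjoint.hyperspecialSubgroup R (T5HermitianThreeElements.J3 u))
            (T5HeckeBasisCells.cellU hϖ hs u n) :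
            T5HeckePermutationModule.heckeAlgebra k
              (T5UnitaryHeckeAdjoint.hyperspecialSubgroup R (T5HermitianThreeElements.J3 u))) :
            Module.End k (MonoidAlgebra k
              (T5UnitaryGroupForm.formUnitaryGroup (T5HermitianThreeElements.J3 u) ⧸
                T5UnitaryHeckeAdjoint.hyperspecialSubgroup R (T5HermitianThreeElements.J3 u))))
            (MonoidAlgebra.single
              (↑(1 : T5UnitaryGroupForm.formUnitaryGroup (T5HermitianThreeElements.J3 u))) (1 : k))).coeff
          (T5HeckeBasisCells.cellU hϖ hs u (n + 1)) = 1) :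
    Function.Bijective
      (Polynomial.aeval (T5HeckeBasisCells.heckeBasisCells hstar u hsu hu0 hu hu' hϖ hs k 1) :
        Polynomial k →ₐ[k] _) := by
  apply T5HeckePolynomialAlgebra.heckeAlgebra_aeval_bijective hstar u hsu hu0 hu hu' hϖ hs k
  intro n
  rw [mul_cellU_eq_sum hstar u hsu hu0 hu hu' hϖ hs k 1 n, Finset.sum_range_succ, htop n, one_smul]
  have hc : ∀ (X Y : T5HeckePermutationModule.heckeAlgebra k
      (T5UnitaryHeckeAdjoint.hyperspecialSubgroup R (T5HermitianThreeElements.J3 u))), X + Y - Y = X :=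
    fun X Y => add_sub_cancel_right X Y
  rw [hc]
  exact Submodule.sum_mem _ fun m hm =>
    Submodule.smul_mem _ _ (subset_span ⟨m, Finset.mem_range.mp hm, rfl⟩)

end Cells

end Summit.Ventures.HodgeRepro2.T5HeckeCellFiltration
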